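import Literature.MathematicalPhysics.QuantumFieldTheory.Balaban1983to89.BlockAveragingEMLProp2
import HarnessLib

/-!
# `AlphaInputsT3ACv3FourBlockGeom` — THE FOUR-BLOCK BOX `Δ(p′) = B(y) ∪ B(y+e_μ) ∪ B(y+e_ν) ∪ B(y+e_μ+e_ν)` OF A COARSE PLAQUETTE:
# product-set description, block membership from centred coordinates, and the atoms of the sharp [Balaban1985Averaging] Prop. 1 for (0.4)
# (transport loops, straight and translated `L × L` squares) STAY IN IT — lane `pub-balaban3d`, seat alpha-2 (g4)

WHY (HOME `pub-balaban3d` STATUS, alpha-2 g4).  The sharp one-step bound `BlockAveragingEMLProp2.dist1_plaqHol_avgFun_le_of_atoms` takes as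
hypotheses only the sizes of its ATOMS: the (0.4) loop variables at the four bonds of `∂p′`, the transport loops
`Γ^σ(n) (+μ)^L (+ν)^L (Γ^ρ(n))⁻¹ (−ν)^L (−μ)^L`, the straight coarse square and its translates `(p′)_x`.  All of them are walks INSIDE the
four blocks under the corners of `p′` — print's «Δ(p′)» (p.25: «the bound above depends on bounds for V(∂p) − 1 on Δ(p′)»).  With the box-local
Stokes bound of the siblings `…v3BoxStokesDefect` ∕ `…v3BoxStokes` this gives Prop. 1 with the PRINTED locality (sibling `…v3Prop1Blocks`);
THIS FILE is the geometry: §1 `blockOf_mem_four_of_near` (a level-`j` site at centred offset `e` from `emb y`, `−h ≤ e_κ ≤ h + L·[κ ∈ {μ,ν}]`,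
`h = (L−1)/2`, has its block among the four corners; standing range) and the product-set form `blockOf_mem_four_iff`; §2 every prefix of the
transport word has such an offset (`netDisp_take_zWord`); §3 the plaquettes tiled by the straight ∕ translated `L × L` squares have lower-left
and upper-right corners in the box (`blockOf_rectPlaq_mem_four`), hence `dist1_rect_le_fourBlock` (`≤ L²·a` from the box's plaquettes, exact
lattice Stokes `B10Eq47AxialChi.dist1_rect_le`).
HONEST FRAMING.  Lattice combinatorics; nothing of [Balaban1985Averaging] asserted; count-neutral helper toward R3 2′ (`stub_laneRecordsV3`,
items 19935∕19936); registry untouched; nothing about d = 4, the continuum, or a mass gap.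

References: T. Bałaban, Commun. Math. Phys. 98 (1985) 17–51 [Balaban1985Averaging] (Prop. 1 (51) pp.25–26); CMP 109 (1987) 249–301
[Balaban1987RG1] ((0.3)–(0.4) pp.252–253).
-/

set_option autoImplicit false

namespace Summit.QuantumFields.YangMills.Theorems.BoxStokes

open Literature.MathematicalPhysics.QuantumFieldTheory.Balaban1983to89
open T4Continuum T4ReflectionCone BlockAveraging B10Eq47AxialChi BlockAveragingEMLProp2

variable {P : Params} {j : ℕ}

/-! ## §1 The four-block box of a coarse plaquette -/

section Box

/-- **BLOCK MEMBERSHIP FROM CENTRED COORDINATES, FOUR-BLOCK FORM** (standing range `j + 1 ≤ m + K`): a level-`j` site `s = emb y + e` with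
`−h ≤ e_κ ≤ h` off the plane and `−h ≤ e_κ ≤ h + L` for `κ ∈ {μ, ν}` (`h = (L−1)/2`) lies in one of the four blocks `y, y+e_μ, y+e_ν, y+e_μ+e_ν`.
[folklore] -/
theorem blockOf_mem_four_of_near (hj : j + 1 ≤ P.m + P.K) (y : Site P (j + 1)) {μ ν : Fin P.d} (hμν : μ ≠ ν) (s : Site P j)
    (e : Fin P.d → ℤ) (hs : ∀ κ, s κ = emb y κ + ((e κ : ℤ) : ZMod (P.sitesPerDir j)))
    (hlo : ∀ κ, -(((P.L - 1) / 2 : ℕ) : ℤ) ≤ e κ)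
    (hhi : ∀ κ, e κ ≤ (if κ = μ ∨ κ = ν then (P.L : ℤ) else 0) + (((P.L - 1) / 2 : ℕ) : ℤ)) :
    blockOf s = y ∨ blockOf s = y.shift μ ∨ blockOf s = y.shift ν ∨ blockOf s = (y.shift μ).shift ν := by
  have hL := AveragingRT.two_mul_half_add_one P
  set h : ℕ := (P.L - 1) / 2 with hh
  -- the shifted offsets
  have key : ∀ (α β : Bool), (α = true ↔ (h : ℤ) < e μ) → (β = true ↔ (h : ℤ) < e ν) →
      blockOf s = (if α then (if β then (y.shift μ).shift ν else y.shift μ) else (if β then y.shift ν else y)) := by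
    intro α β hα hβ
    set y' : Site P (j + 1) := if α then (if β then (y.shift μ).shift ν else y.shift μ) else (if β then y.shift ν else y) with hy'
    have hemb : ∀ κ, emb y' κ = emb y κ + (if κ = μ ∧ α = true then (P.L : ZMod (P.sitesPerDir j)) else 0) +
        (if κ = ν ∧ β = true then (P.L : ZMod (P.sitesPerDir j)) else 0) := by
      intro κ
      rw [hy']
      cases α <;> cases β <;> simp [emb_shift_apply]
    refine blockOf_eq_of_near_emb hj y' s
      (fun κ => e κ - (if κ = μ ∧ α = true then (P.L : ℤ) else 0) - (if κ = ν ∧ β = true then (P.L : ℤ) else 0)) ?_ ?_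
    · intro κ
      rw [hs κ, hemb κ]
      push_cast
      split_ifs <;> ring
    · intro κ
      have h1 := hlo κ
      have h2 := hhi κ
      by_cases hκμ : κ = μ
      · subst hκμ
        have hne : ¬ (κ = ν) := hμν
        simp only [true_or, if_true, true_and, hne, false_and, if_false, sub_zero] at h2 ⊢
        cases α
        · have : ¬ ((h : ℤ) < e κ) := fun hc => by have := hα.2 hc; exact Bool.false_ne_true this
          simp only [Bool.false_eq_true, if_false, sub_zero]
          constructor <;> omega
        · have : (h : ℤ) < e κ := hα.1 rfl
          simp only [if_true]
          constructor <;> omega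
      · by_cases hκν : κ = ν
        · subst hκν
          simp only [or_true, if_true, true_and, hκμ, false_and, if_false, sub_zero] at h2 ⊢
          cases β
          · have : ¬ ((h : ℤ) < e κ) := fun hc => by have := hβ.2 hc; exact Bool.false_ne_true this
            simp only [Bool.false_eq_true, if_false, sub_zero]
            constructor <;> omega
          · have : (h : ℤ) < e κ := hβ.1 rfl
            simp only [if_true]
            constructor <;> omega
        · simp only [hκμ, hκν, or_self, if_false, false_and, sub_zero, zero_add] at h2 ⊢
          constructor <;> omega
  by_cases hα : (h : ℤ) < e μ <;> by_cases hβ : (h : ℤ) < e ν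
  · right; right; right; simpa using key true true (by simp [hα]) (by simp [hβ])
  · right; left; simpa using key true false (by simp [hα]) (by simp [hβ])
  · right; right; left; simpa using key false true (by simp [hα]) (by simp [hβ])
  · left; simpa using key false false (by simp [hα]) (by simp [hβ])

/-- **THE FOUR-BLOCK BOX IS A PRODUCT SET**: `blockOf z ∈ {y, y+e_μ, y+e_ν, y+e_μ+e_ν}` iff every coordinate of `z` has its block coordinate among
the corresponding coordinates of the four corners (the corners differ in the coordinates `μ`, `ν` only). [folklore] -/
theorem blockOf_mem_four_iff (y : Site P (j + 1)) {μ ν : Fin P.d} (hμν : μ ≠ ν) (z : Site P j) :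
    (blockOf z = y ∨ blockOf z = y.shift μ ∨ blockOf z = y.shift ν ∨ blockOf z = (y.shift μ).shift ν) ↔
      z ∈ {z : Site P j | ∀ κ, z κ ∈ (fun κ => {t : ZMod (P.sitesPerDir j) |
        (((t.val / P.L : ℕ) : ZMod (P.sitesPerDir (j + 1))) = y κ) ∨
        (((t.val / P.L : ℕ) : ZMod (P.sitesPerDir (j + 1))) = (y.shift μ) κ) ∨
        (((t.val / P.L : ℕ) : ZMod (P.sitesPerDir (j + 1))) = (y.shift ν) κ) ∨
        (((t.val / P.L : ℕ) : ZMod (P.sitesPerDir (j + 1))) = ((y.shift μ).shift ν) κ)}) κ} := by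
  simp only [Set.mem_setOf_eq]
  have hb : ∀ κ, blockOf z κ = ((((z κ).val / P.L : ℕ)) : ZMod (P.sitesPerDir (j + 1))) := fun κ => rfl
  constructor
  · rintro (h | h | h | h) κ <;> rw [← hb, h] <;> simp
  · intro h
    -- coordinates off the plane agree with `y`
    have hoff : ∀ κ, κ ≠ μ → κ ≠ ν → blockOf z κ = y κ := by
      intro κ h1 h2
      rcases h κ with h3 | h3 | h3 | h3 <;> rw [hb] <;> rw [h3] <;> simp [Site.shift_apply, h1, h2]
    have hμ' : blockOf z μ = y μ ∨ blockOf z μ = y μ + 1 := by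
      rcases h μ with h3 | h3 | h3 | h3 <;> rw [hb, h3] <;> simp [Site.shift_apply, hμν]
    have hν' : blockOf z ν = y ν ∨ blockOf z ν = y ν + 1 := by
      rcases h ν with h3 | h3 | h3 | h3 <;> rw [hb, h3] <;> simp [Site.shift_apply, Ne.symm hμν]
    have build : ∀ (a b : ZMod (P.sitesPerDir (j + 1))), blockOf z μ = a → blockOf z ν = b →
        ∀ y' : Site P (j + 1), y' μ = a → y' ν = b → (∀ κ, κ ≠ μ → κ ≠ ν → y' κ = y κ) → blockOf z = y' := by
      intro a b ha hb' y' h1 h2 h3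
      funext κ
      by_cases hκ : κ = μ
      · rw [hκ, ha, h1]
      · by_cases hκ' : κ = ν
        · rw [hκ', hb', h2]
        · rw [hoff κ hκ hκ', h3 κ hκ hκ']
    rcases hμ' with ha | ha <;> rcases hν' with hb' | hb'
    · left; exact build _ _ ha hb' y rfl rfl (fun κ _ _ => rfl)
    · right; right; left
      exact build _ _ ha hb' (y.shift ν) (by simp [Site.shift_apply, hμν]) (by simp [Site.shift_apply])
        (fun κ h1 h2 => by simp [Site.shift_apply, h2])
    · right; left
      exact build _ _ ha hb' (y.shift μ) (by simp [Site.shift_apply]) (by simp [Site.shift_apply, Ne.symm hμν])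
        (fun κ h1 h2 => by simp [Site.shift_apply, h1])
    · right; right; right
      exact build _ _ ha hb' ((y.shift μ).shift ν) (by simp [Site.shift_apply, hμν]) (by simp [Site.shift_apply, Ne.symm hμν])
        (fun κ h1 h2 => by simp [Site.shift_apply, h1, h2])

end Box

/-! ## §2 Every prefix of the transport word stays in the four-block box -/

section ZWord

variable {d : ℕ}

/-- **PREFIXES OF THE TRANSPORT WORD `Γ^σ(n) (+μ)^L (+ν)^L (Γ^ρ(n))⁻¹ (−ν)^L (−μ)^L`** (offsets `|n_κ| ≤ h`): the displacement in direction `κ`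
lies in `[−h, L·[μ = κ] + L·[ν = κ] + h]`. [folklore] -/
theorem netDisp_take_zWord {L h : ℕ} (μ ν : Fin d) (n : Fin d → ℤ) (hn : ∀ κ, -(h : ℤ) ≤ n κ ∧ n κ ≤ h)
    (σ ρ : Equiv.Perm (Fin d)) (k : ℕ) (κ : Fin d) :
    -(h : ℤ) ≤ netDisp ((stairWord σ n ++ (List.replicate L (μ, true) ++ (List.replicate L (ν, true) ++
      (wordRev (stairWord ρ n) ++ (List.replicate L (ν, false) ++ List.replicate L (μ, false)))))).take k) κ ∧
    netDisp ((stairWord σ n ++ (List.replicate L (μ, true) ++ (List.replicate L (ν, true) ++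
      (wordRev (stairWord ρ n) ++ (List.replicate L (ν, false) ++ List.replicate L (μ, false)))))).take k) κ ≤
      (if μ = κ then (L : ℤ) else 0) + (if ν = κ then (L : ℤ) else 0) + h := by
  have hS := netDisp_take_stairWord σ n κ
  have hS' := netDisp_take_stairWord ρ n κ
  have hnκ := hn κ
  -- the indicator letters
  set X : ℤ := (if μ = κ then (L : ℤ) else 0) with hX
  set Y : ℤ := (if ν = κ then (L : ℤ) else 0) with hY
  have hX0 : 0 ≤ X := by rw [hX]; split_ifs <;> omega
  have hY0 : 0 ≤ Y := by rw [hY]; split_ifs <;> omega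
  have hXL : X ≤ L := by rw [hX]; split_ifs <;> omega
  have hYL : Y ≤ L := by rw [hY]; split_ifs <;> omega
  -- the letter values of the four runs
  have vμt : (if ((μ, true) : Letter d).1 = κ then (if ((μ, true) : Letter d).2 then (1 : ℤ) else -1) else 0) =
      (if μ = κ then (1 : ℤ) else 0) := by simp
  have vνt : (if ((ν, true) : Letter d).1 = κ then (if ((ν, true) : Letter d).2 then (1 : ℤ) else -1) else 0) =
      (if ν = κ then (1 : ℤ) else 0) := by simp
  have vμf : (if ((μ, false) : Letter d).1 = κ then (if ((μ, false) : Letter d).2 then (1 : ℤ) else -1) else 0) =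
      (if μ = κ then (-1 : ℤ) else 0) := by simp
  have vνf : (if ((ν, false) : Letter d).1 = κ then (if ((ν, false) : Letter d).2 then (1 : ℤ) else -1) else 0) =
      (if ν = κ then (-1 : ℤ) else 0) := by simp
  -- `m·[μ = κ]` is between `0` and `X` for `m ≤ L`, etc.
  have runμ : ∀ m : ℕ, m ≤ L → 0 ≤ (m : ℤ) * (if μ = κ then (1 : ℤ) else 0) ∧ (m : ℤ) * (if μ = κ then (1 : ℤ) else 0) ≤ X := by
    intro m hm; rw [hX]; split_ifs <;> constructor <;> nlinarith
  have runν : ∀ m : ℕ, m ≤ L → 0 ≤ (m : ℤ) * (if ν = κ then (1 : ℤ) else 0) ∧ (m : ℤ) * (if ν = κ then (1 : ℤ) else 0) ≤ Y := by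
    intro m hm; rw [hY]; split_ifs <;> constructor <;> nlinarith
  have runμ' : ∀ m : ℕ, m ≤ L → -X ≤ (m : ℤ) * (if μ = κ then (-1 : ℤ) else 0) ∧ (m : ℤ) * (if μ = κ then (-1 : ℤ) else 0) ≤ 0 := by
    intro m hm; rw [hX]; split_ifs <;> constructor <;> nlinarith
  have runν' : ∀ m : ℕ, m ≤ L → -Y ≤ (m : ℤ) * (if ν = κ then (-1 : ℤ) else 0) ∧ (m : ℤ) * (if ν = κ then (-1 : ℤ) else 0) ≤ 0 := by
    intro m hm; rw [hY]; split_ifs <;> constructor <;> nlinarith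
  have fullμ : ((L : ℕ) : ℤ) * (if μ = κ then (1 : ℤ) else 0) = X := by rw [hX]; split_ifs <;> simp
  have fullν : ((L : ℕ) : ℤ) * (if ν = κ then (1 : ℤ) else 0) = Y := by rw [hY]; split_ifs <;> simp
  have fullν' : ((L : ℕ) : ℤ) * (if ν = κ then (-1 : ℤ) else 0) = -Y := by rw [hY]; split_ifs <;> simp
  rcases take_append_cases (stairWord σ n)
    (List.replicate L (μ, true) ++ (List.replicate L (ν, true) ++
      (wordRev (stairWord ρ n) ++ (List.replicate L (ν, false) ++ List.replicate L (μ, false))))) k with h1 | h1 <;> rw [h1]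
  · have := hS k
    constructor <;> omega
  rw [T4ReflectionCone.netDisp_append, netDisp_stairWord]
  rcases take_append_cases (List.replicate L (μ, true))
    (List.replicate L (ν, true) ++ (wordRev (stairWord ρ n) ++ (List.replicate L (ν, false) ++ List.replicate L (μ, false))))
    (k - (stairWord σ n).length) with h2 | h2 <;> rw [h2]
  · rw [netDisp_take_replicate, vμt]
    have := runμ _ (min_le_right (k - (stairWord σ n).length) L)
    constructor <;> omega
  rw [T4ReflectionCone.netDisp_append, T4ReflectionCone.netDisp_replicate, List.length_replicate, vμt, fullμ]
  rcases take_append_cases (List.replicate L (ν, true))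
    (wordRev (stairWord ρ n) ++ (List.replicate L (ν, false) ++ List.replicate L (μ, false)))
    (k - (stairWord σ n).length - L) with h3 | h3 <;> rw [h3]
  · rw [netDisp_take_replicate, vνt]
    have := runν _ (min_le_right (k - (stairWord σ n).length - L) L)
    constructor <;> omega
  rw [T4ReflectionCone.netDisp_append, T4ReflectionCone.netDisp_replicate, List.length_replicate, vνt, fullν]
  rcases take_append_cases (wordRev (stairWord ρ n)) (List.replicate L (ν, false) ++ List.replicate L (μ, false))
    (k - (stairWord σ n).length - L - L) with h4 | h4 <;> rw [h4]
  · obtain ⟨m, hm⟩ := netDisp_take_wordRev (stairWord ρ n) (k - (stairWord σ n).length - L - L)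
    rw [hm κ, netDisp_stairWord]
    have := hS' m
    constructor <;> omega
  rw [T4ReflectionCone.netDisp_append, netDisp_wordRev, netDisp_stairWord]
  rcases take_append_cases (List.replicate L (ν, false)) (List.replicate L (μ, false))
    (k - (stairWord σ n).length - L - L - (wordRev (stairWord ρ n)).length) with h5 | h5 <;> rw [h5]
  · rw [netDisp_take_replicate, vνf]
    have := runν' _ (min_le_right (k - (stairWord σ n).length - L - L - (wordRev (stairWord ρ n)).length) L)
    constructor <;> omega
  rw [T4ReflectionCone.netDisp_append, T4ReflectionCone.netDisp_replicate, List.length_replicate, vνf, fullν', netDisp_take_replicate, vμf]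
  have := runμ' _ (min_le_right (k - (stairWord σ n).length - L - L - (wordRev (stairWord ρ n)).length - L) L)
  constructor <;> omega

end ZWord

/-! ## §3 The plaquettes tiled by the straight and translated `L × L` squares lie in the four-block box -/

section Squares

/-- `(x + e_μ)_κ = x_κ + [κ = μ]` (additive form of `Site.shift_apply`). [folklore] -/
theorem shift_apply_add (x : Site P j) (μ κ : Fin P.d) :
    (x.shift μ) κ = x κ + (if κ = μ then (1 : ZMod (P.sitesPerDir j)) else 0) := by
  by_cases h : κ = μ
  · subst h; simp [Site.shift]
  · simp [Site.shift, h]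

/-- **THE PLAQUETTES OF AN `L × L` SQUARE BASED IN `B(y)` HAVE BOTH EXTREME CORNERS IN THE FOUR-BLOCK BOX**: for `x = emb y + e`, `|e_κ| ≤ h`, and
`s, t < L`, the plaquette at `x + t e_ν + s e_μ` in the plane `μν` has its lower-left corner and its upper-right corner in blocks among
`y, y+e_μ, y+e_ν, y+e_μ+e_ν` (standing range). [folklore] -/
theorem blockOf_rectPlaq_mem_four (hj : j + 1 ≤ P.m + P.K) (y : Site P (j + 1)) {μ ν : Fin P.d} (hμν : μ ≠ ν) (x : Site P j)
    (e : Fin P.d → ℤ) (hx : ∀ κ, x κ = emb y κ + ((e κ : ℤ) : ZMod (P.sitesPerDir j)))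
    (he : ∀ κ, -(((P.L - 1) / 2 : ℕ) : ℤ) ≤ e κ ∧ e κ ≤ (((P.L - 1) / 2 : ℕ) : ℤ)) {s t : ℕ} (hs : s < P.L) (ht : t < P.L) :
    (blockOf (shiftN (shiftN x ν t) μ s) = y ∨ blockOf (shiftN (shiftN x ν t) μ s) = y.shift μ ∨
      blockOf (shiftN (shiftN x ν t) μ s) = y.shift ν ∨ blockOf (shiftN (shiftN x ν t) μ s) = (y.shift μ).shift ν) ∧
    (blockOf (((shiftN (shiftN x ν t) μ s).shift μ).shift ν) = y ∨ blockOf (((shiftN (shiftN x ν t) μ s).shift μ).shift ν) = y.shift μ ∨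
      blockOf (((shiftN (shiftN x ν t) μ s).shift μ).shift ν) = y.shift ν ∨
      blockOf (((shiftN (shiftN x ν t) μ s).shift μ).shift ν) = (y.shift μ).shift ν) := by
  have hL := AveragingRT.two_mul_half_add_one P
  constructor
  · refine blockOf_mem_four_of_near hj y hμν _
      (fun κ => e κ + (if κ = ν then (t : ℤ) else 0) + (if κ = μ then (s : ℤ) else 0)) ?_ ?_ ?_
    · intro κ
      rw [shiftN_apply, shiftN_apply, hx κ]
      push_cast
      split_ifs <;> ring
    · intro κ; have := (he κ).1; split_ifs <;> omega
    · intro κ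
      have := (he κ).2
      by_cases h1 : κ = μ
      · subst h1; simp only [true_or, if_true, show ¬ (κ = ν) from hμν, if_false, add_zero]; omega
      · by_cases h2 : κ = ν
        · subst h2; simp only [or_true, if_true, h1, if_false, add_zero]; omega
        · simp only [h1, h2, or_self, if_false, add_zero]; omega
  · refine blockOf_mem_four_of_near hj y hμν _
      (fun κ => e κ + (if κ = ν then (t : ℤ) else 0) + (if κ = μ then (s : ℤ) else 0) + (if κ = μ then 1 else 0) + (if κ = ν then 1 else 0))
      ?_ ?_ ?_
    · intro κ
      rw [shift_apply_add, shift_apply_add, shiftN_apply, shiftN_apply, hx κ]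
      push_cast
      split_ifs <;> ring
    · intro κ; have := (he κ).1; split_ifs <;> omega
    · intro κ
      have := (he κ).2
      by_cases h1 : κ = μ
      · subst h1; simp only [true_or, if_true, show ¬ (κ = ν) from hμν, if_false, add_zero]; omega
      · by_cases h2 : κ = ν
        · subst h2; simp only [or_true, if_true, h1, if_false, add_zero]; omega
        · simp only [h1, h2, or_self, if_false, add_zero]; omega

variable {G : Type*} [GaugeGroup G]

/-- **AN `L × L` SQUARE BASED IN `B(y)` IS WITHIN `L²·a` OF `1` FROM THE PLAQUETTES OF THE FOUR-BLOCK BOX** (exact lattice Stokes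
`B10Eq47AxialChi.dist1_rect_le`: the `L²` tiled plaquettes, each within `a` by the box hypothesis). [cite: Balaban1985Averaging, (19)–(20) p.21] -/
theorem dist1_rect_le_fourBlock (hj : j + 1 ≤ P.m + P.K) (y : Site P (j + 1)) {μ ν : Fin P.d} (hμν : μ < ν) {a : ℝ}
    (U : GaugeField P j G)
    (hU : ∀ q : Plaq P j,
      (blockOf q.src = y ∨ blockOf q.src = y.shift μ ∨ blockOf q.src = y.shift ν ∨ blockOf q.src = (y.shift μ).shift ν) →
      (blockOf ((q.src.shift q.μ).shift q.ν) = y ∨ blockOf ((q.src.shift q.μ).shift q.ν) = y.shift μ ∨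
        blockOf ((q.src.shift q.μ).shift q.ν) = y.shift ν ∨ blockOf ((q.src.shift q.μ).shift q.ν) = (y.shift μ).shift ν) →
      dist1 (GaugeField.plaqHol U q) ≤ a)
    (x : Site P j) (e : Fin P.d → ℤ) (hx : ∀ κ, x κ = emb y κ + ((e κ : ℤ) : ZMod (P.sitesPerDir j)))
    (he : ∀ κ, -(((P.L - 1) / 2 : ℕ) : ℤ) ≤ e κ ∧ e κ ≤ (((P.L - 1) / 2 : ℕ) : ℤ)) :
    dist1 (rect U x μ ν P.L P.L) ≤ (P.L : ℝ) ^ 2 * a := by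
  refine (dist1_rect_le U x hμν P.L P.L).trans ?_
  calc ∑ t ∈ Finset.range P.L, ∑ s ∈ Finset.range P.L, dist1 (GaugeField.plaqHol U ⟨shiftN (shiftN x ν t) μ s, μ, ν, hμν⟩)
      ≤ ∑ t ∈ Finset.range P.L, ∑ s ∈ Finset.range P.L, a := by
        refine Finset.sum_le_sum fun t ht => Finset.sum_le_sum fun s hs => ?_
        obtain ⟨h1, h2⟩ := blockOf_rectPlaq_mem_four hj y (ne_of_lt hμν) x e hx he (Finset.mem_range.mp hs) (Finset.mem_range.mp ht)
        exact hU _ h1 h2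
    _ = (P.L : ℝ) ^ 2 * a := by simp [Finset.sum_const, Finset.card_range]; ring

end Squares

end Summit.QuantumFields.YangMills.Theorems.BoxStokes
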